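import Summits.QuantumFields.BalabanUV.Beta.GAN24.SubAveragingKernelL2

/-!
# `BalabanUV.Beta.GAN24.SubAveragingUnitTower` — binder row G-an2-4 ∕ (CONV-C), programme «SUBAVG-RATE», FILE 6:
# THE UNIT-READ COROLLARY IN (CONV-C)'s TWO-CLAUSE SHAPE — the block-MEAN over the fine leg of `G_jQ_j^*` (B4 (2.48), `U = 1`) is a
# unit-lattice kernel `K_j : ℤ^{d+1} → ℂ` with `j`-UNIFORM exponential decay AND the geometric one-step rate `θ = L⁻²` with the same decay

NOT IN PRINT; OUR PROOF ATTEMPT (prover part P3 of row G-an2-4, fibre∕strip lineage, gen 22; CRUX TEAM (2), ruling «YM REDIRECT TOWARDS THE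
SUMMIT», 2026-08-21).  HONEST DEPENDENCY (cell records, verbatim): «continuum YM on T⁴ ⇐ BetaPertH ∧ nine spine estimates (0/9 proved);
BetaPertH ⇐ (D1) ∧ (D4) ∧ CAP+tail; G-an2-4 gates asym, D1 and NE2/3/4.»  HONEST FRAMING (cell contract, verbatim): «discharging `BetaPertH`
makes Bałaban's UV stability UNCONDITIONAL — a real constructive-QFT result; it is NOT the continuum limit and NOT the Clay problem.»  ABSOLUTE
RULE: nothing printed is a hypothesis.  [folklore] assembly over `B4StripSums.kernel248_decay` (B4 Lemma 2.4 (2.35) for `G_jQ_j^*`, the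
`j`-UNIFORM half, vendored with its citation tag) and the siblings `SubAveragingKernel` ∕ `SubAveragingKernelL2` (the rate half).  No
`def … : Prop`, no sorry.

## Statement (`unitTower_two_clauses`)
`Kunit n a m2 x := (n^{d+1})⁻¹ Σ_{τ ∈ (Fin n)^{d+1}} latticeKernel (G n a m2 τ) x` — the MEAN over the `n^{d+1}` fine sites of a unit block of the
kernel `(G_jQ_j^*)(y + τ∕n, y′)`, `x = y − y′ ∈ ℤ^{d+1}`, `n = L^j`.  For every `a > 0`, `m² ≥ 0`, `L ≥ 1` there are `κ > 0`, `C ≥ 0` with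
 (i) `‖Kunit (L^j) a m2 x‖ ≤ C·e^{−κ|x|_∞}` for every `j`, `x` (uniform decay), and
 (ii) `‖Kunit (L^{j+1}) a m2 x − Kunit (L^j) a m2 x‖ ≤ C·(L²)^{−j}·e^{−κ|x|_∞}` for every `j`, `x` (geometric Cauchy, SHARP `θ = L⁻²`, NO logarithm)
— literally the two clauses of the cell's (CONV-C) shape (`GAN24.DirichletExhaustion.ConvC`, there for real kernels on `K d N`) for this
unit-lattice-indexed constituent, on the INFINITE lattice.  Mechanism of (ii): mean over `τ` ≤ block-RMS (Cauchy–Schwarz) and FILE 5's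
`subavg_kernel_rate_rms`; the finer block mean IS the mean of the sub-cell averages (`sum_Tsub_eq`).

## Customers, species, dictionary (answering the crux refuter's (r2)(r3), PRICING-GAN24 v3.1 §5 «P3-g22»)
CUSTOMERS (both PARKED under e34b3e0c): asym1's `LimitForm.conv` constituent list (the insurance sibling of row D1's END) and the NE2 sub-row
`T4-U1a.S-NE2-D3-WALK°`.  It is NOT (ρ2)∕(ρ3) and NOT a D1 input (zero on the D1 grid).  SPECIES: B4 (2.48) soft-minimiser column `G_jQ_j^*`,
`G_j = (−Δ^ξ + m² + aQ_j^*Q_j)⁻¹`, at `U = 1`, block-MEAN over the fine leg.  DICTIONARY: this is the SAME SPECIES as R0's `unitCovB` of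
`Support/BalabanAveragedTowerUnit` (`Q_k𝒢_kQ_k^*`, `𝒢 = Δ_a⁻¹`) up to (plain block mean on `ℤ^{d+1}`) vs (Bałaban's (1.18) line-average on a
torus) — R0 delivers the WEAK exponent `(√L)⁻¹` there, this file the sharp `L⁻²` here; it is NOT road P2's `C^{(k)}(𝟙)` (the δ-constrained
fluctuation covariance of `DirichletExhaustionCoer.convC_balaban`) and NOT the vector `H_k` of B5 (1.63).  Nobody should derive a fourth cousin
from this file without saying which of the three it is.

NOT HERE: composites, `U ≠ 1`, the vector case.  NEVER «G-an2-4 closed»; NOT D1, NOT BetaPertH, NOT continuum, NOT Clay.  Provenance: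
prover-b2b-balaban-gan24-p3-g22-0 (unit `b2b-balaban-gan24-p3`, gen 22), 2026-08-21.
-/

noncomputable section

namespace Summit.QuantumFields.BalabanUV.Beta.GAN24.SubAveragingUnitTower

open Complex Finset
open Literature.MathematicalPhysics.QuantumFieldTheory.Balaban1983to89
open Literature.MathematicalPhysics.QuantumFieldTheory.Balaban1983to89.B4Strip
open Literature.MathematicalPhysics.QuantumFieldTheory.Balaban1983to89.B4StripCauchy
open Literature.MathematicalPhysics.QuantumFieldTheory.Balaban1983to89.B4StripSums
open Literature.MathematicalPhysics.QuantumFieldTheory.Balaban1983to89.B4ContourShift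
open Summit.QuantumFields.BalabanUV.Beta.FP.ConstrainedBiLaplacianParseval (sqNorm sqNorm_nonneg norm_sum_mul_le)
open Summit.QuantumFields.BalabanUV.Beta.GAN24.SubAveragingCore
open Summit.QuantumFields.BalabanUV.Beta.GAN24.SubAveragingFibreColumn
open Summit.QuantumFields.BalabanUV.Beta.GAN24.SubAveragingKernel
open Summit.QuantumFields.BalabanUV.Beta.GAN24.SubAveragingKernelL2
open scoped Real

variable {d : ℕ}

/-! ## §1 The block mean over the fine leg and its two-level re-indexing -/

/-- [folklore] THE UNIT-READ KERNEL: the mean over the `n^{d+1}` fine sites `τ` of a unit block of the kernel of `G_jQ_j^*` at separation `x`. -/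
def Kunit (n : ℕ) [NeZero n] (a m2 : ℝ) (x : Fin (d + 1) → ℤ) : ℂ :=
  (((n : ℂ) ^ (d + 1)))⁻¹ * ∑ τ : Fin (d + 1) → Fin n, latticeKernel (G n a m2 τ) x

/-- [folklore] `(τ, ρ) ↦ Tsub τ ρ = L·τ + ρ` is injective. -/
theorem Tsub_injective (n L : ℕ) [NeZero L] :
    Function.Injective (fun tr : (Fin d → Fin n) × (Fin d → Fin L) => Tsub n L tr.1 tr.2) := by
  rintro ⟨τ, ρ⟩ ⟨τ', ρ'⟩ h
  have hν : ∀ ν, L * (τ ν : ℕ) + (ρ ν : ℕ) = L * (τ' ν : ℕ) + (ρ' ν : ℕ) := fun ν => by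
    have := congrArg (fun T => ((T ν : Fin (n * L)) : ℕ)) h
    simpa [Tsub_val] using this
  have hρ : ρ = ρ' := by
    funext ν
    apply Fin.ext
    have h1 := congrArg (· % L) (hν ν)
    simp only [Nat.mul_add_mod, Nat.mod_eq_of_lt (ρ ν).isLt, Nat.mod_eq_of_lt (ρ' ν).isLt] at h1
    exact h1
  subst hρ
  have hτ : τ = τ' := by
    funext ν
    apply Fin.ext
    have h1 := hν ν
    have hL := Nat.pos_of_ne_zero (NeZero.ne L)
    have : L * (τ ν : ℕ) = L * (τ' ν : ℕ) := by omega
    exact Nat.eq_of_mul_eq_mul_left hL this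
  rw [hτ]

/-- [folklore] `(τ, ρ) ↦ Tsub τ ρ` is a bijection onto the finer sites (`n^{d}·L^{d} = (nL)^{d}`). -/
theorem Tsub_bijective (n L : ℕ) [NeZero L] :
    Function.Bijective (fun tr : (Fin d → Fin n) × (Fin d → Fin L) => Tsub n L tr.1 tr.2) := by
  rw [Fintype.bijective_iff_injective_and_card]
  refine ⟨Tsub_injective n L, ?_⟩
  simp only [Fintype.card_prod, Fintype.card_pi, Finset.prod_const, Fintype.card_fin, Finset.card_univ]
  rw [← mul_pow]

/-- [folklore] RE-INDEXING OF THE FINER BLOCK: `Σ_{τ′ ∈ (Fin (nL))^{d}} f τ′ = Σ_τ Σ_ρ f (Tsub τ ρ)`. -/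
theorem sum_Tsub_eq (n L : ℕ) [NeZero L] (f : (Fin d → Fin (n * L)) → ℂ) :
    ∑ T : Fin d → Fin (n * L), f T = ∑ τ : Fin d → Fin n, ∑ ρ : Fin d → Fin L, f (Tsub n L τ ρ) := by
  rw [← Fintype.sum_prod_type']
  exact (Function.Bijective.sum_comp (Tsub_bijective n L) f).symm

/-- [folklore] **THE FINER BLOCK MEAN IS THE MEAN OF THE SUB-CELL AVERAGES**:
`Kunit (n·L) x = (n^{d+1})⁻¹ Σ_τ [(L^{d+1})⁻¹ Σ_ρ latticeKernel (G (n·L) (Tsub τ ρ)) x]`. -/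
theorem Kunit_mul_eq (n L : ℕ) [NeZero n] [NeZero L] (a m2 : ℝ) (x : Fin (d + 1) → ℤ) :
    Kunit (n * L) a m2 x = (((n : ℂ) ^ (d + 1)))⁻¹ * ∑ τ : Fin (d + 1) → Fin n,
      ((((L : ℂ) ^ (d + 1)))⁻¹ * ∑ ρ : Fin (d + 1) → Fin L, latticeKernel (G (n * L) a m2 (Tsub n L τ ρ)) x) := by
  unfold Kunit
  rw [sum_Tsub_eq, ← Finset.mul_sum, ← mul_assoc]
  congr 1
  push_cast
  rw [mul_pow, mul_inv]

/-! ## §2 The two clauses -/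

/-- [folklore] a mean is bounded by any uniform bound of the terms. -/
theorem norm_mean_le {ι : Type*} [Fintype ι] (N : ℕ) (hN : Fintype.card ι = N) (hN0 : 0 < N) (f : ι → ℂ) {B : ℝ}
    (h : ∀ i, ‖f i‖ ≤ B) : ‖((N : ℂ))⁻¹ * ∑ i, f i‖ ≤ B := by
  have hNr : (0 : ℝ) < N := by exact_mod_cast hN0
  rw [norm_mul, norm_inv, Complex.norm_natCast, inv_mul_le_iff₀ hNr]
  calc ‖∑ i, f i‖ ≤ ∑ i, ‖f i‖ := norm_sum_le _ _
    _ ≤ ∑ _i : ι, B := Finset.sum_le_sum fun i _ => h i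
    _ = N * B := by rw [Finset.sum_const, Finset.card_univ, hN, nsmul_eq_mul]

/-- [folklore] CLAUSE (i) at one level: the block mean inherits the `j`-uniform decay of `kernel248_decay`. -/
theorem norm_Kunit_le (n : ℕ) [NeZero n] (a m2 : ℝ) {κ M : ℝ}
    (h : ∀ (τ : Fin (d + 1) → Fin n) (x : Fin (d + 1) → ℤ), ‖latticeKernel (G n a m2 τ) x‖ ≤ M * Real.exp (-(κ * supNorm x)))
    (x : Fin (d + 1) → ℤ) : ‖Kunit n a m2 x‖ ≤ M * Real.exp (-(κ * supNorm x)) := by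
  unfold Kunit
  have hcard : Fintype.card (Fin (d + 1) → Fin n) = n ^ (d + 1) := by
    rw [Fintype.card_pi, Finset.prod_const, Fintype.card_fin, Finset.card_univ, Fintype.card_fin]
  have hpos : 0 < n ^ (d + 1) := pow_pos (Nat.pos_of_ne_zero (NeZero.ne n)) _
  have e : (((n : ℂ) ^ (d + 1)))⁻¹ = (((n ^ (d + 1) : ℕ) : ℂ))⁻¹ := by push_cast; rfl
  rw [e]
  exact norm_mean_le (n ^ (d + 1)) hcard hpos _ fun τ => h τ x

/-- [folklore] mean over the block ≤ (block size)^{-1∕2} × block-`ℓ²` norm (Cauchy–Schwarz against the constant vector `1`). -/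
theorem norm_mean_le_sqrt {ι : Type*} [Fintype ι] (f : ι → ℂ) :
    ‖∑ i, f i‖ ≤ Real.sqrt (Fintype.card ι) * Real.sqrt (sqNorm f) := by
  have h := norm_sum_mul_le (fun _ : ι => (1 : ℂ)) f
  simp only [one_mul] at h
  have e : sqNorm (fun _ : ι => (1 : ℂ)) = Fintype.card ι := by
    unfold sqNorm; simp
  rw [e] at h
  exact h

/-- [folklore] **THE UNIT-READ COROLLARY — (CONV-C)'s TWO CLAUSES for the block-mean kernels of `G_jQ_j^*` at `U = 1`.**  For every `a > 0`,
`m² ≥ 0`, `L ≥ 1` there are `κ > 0` and `C ≥ 0` such that for every `j` and every `x ∈ ℤ^{d+1}`: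
 (i) `‖Kunit (L^j) a m2 x‖ ≤ C·e^{−κ|x|_∞}`;  (ii) `‖Kunit (L^{j+1}) a m2 x − Kunit (L^j) a m2 x‖ ≤ C·((L²)⁻¹)^j·e^{−κ|x|_∞}`
— `j`-uniform exponential decay AND the geometric one-step rate at the SHARP exponent `θ = L⁻²`, NO logarithm, on the INFINITE lattice. -/
theorem unitTower_two_clauses (d : ℕ) (a m2 : ℝ) (ha : 0 < a) (hm : 0 ≤ m2) (L : ℕ) [NeZero L] :
    ∃ κ C : ℝ, 0 < κ ∧ 0 ≤ C ∧
      (∀ (j : ℕ) (x : Fin (d + 1) → ℤ),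
        ‖@Kunit d (L ^ j) ⟨pow_ne_zero j (NeZero.ne L)⟩ a m2 x‖ ≤ C * Real.exp (-(κ * supNorm x))) ∧
      (∀ (j : ℕ) (x : Fin (d + 1) → ℤ),
        ‖@Kunit d (L ^ (j + 1)) ⟨pow_ne_zero (j + 1) (NeZero.ne L)⟩ a m2 x - @Kunit d (L ^ j) ⟨pow_ne_zero j (NeZero.ne L)⟩ a m2 x‖
          ≤ C * (((L : ℝ) ^ 2)⁻¹) ^ j * Real.exp (-(κ * supNorm x))) := by
  -- the uniform half (B4 Lemma 2.4 for `G_jQ_j^*`, tree) and the rate half (FILE 5), both at the one-point parameter box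
  obtain ⟨κ₁, M, hκ₁, hM, h1⟩ := kernel248_decay d a a m2 ha
  obtain ⟨κ₂, c, hκ₂, hc, h2⟩ := subavg_kernel_rate_rms d a a m2 ha L
  set C₂ : ℝ := 48 ^ (d + 1) * Ccol (d + 1) L a m2 c with hC₂
  have hC₂0 : 0 ≤ C₂ := by
    have := Ccol_nonneg (d + 1) L ha.le hm hc; rw [hC₂]; positivity
  refine ⟨min κ₁ κ₂, max M C₂, lt_min hκ₁ hκ₂, le_max_of_le_left hM, ?_, ?_⟩
  · intro j x
    haveI : NeZero (L ^ j) := ⟨pow_ne_zero j (NeZero.ne L)⟩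
    have h := norm_Kunit_le (L ^ j) a m2 (fun τ x => h1 (L ^ j) a m2 le_rfl le_rfl hm le_rfl τ x) x
    refine h.trans ?_
    have hexp : Real.exp (-(κ₁ * supNorm x)) ≤ Real.exp (-(min κ₁ κ₂ * supNorm x)) :=
      Real.exp_le_exp.mpr (by nlinarith [min_le_left κ₁ κ₂, supNorm_nonneg x])
    exact mul_le_mul (le_max_left _ _) hexp (Real.exp_pos _).le (le_trans hM (le_max_left _ _))
  · intro j x
    haveI hLj : NeZero (L ^ j) := ⟨pow_ne_zero j (NeZero.ne L)⟩
    set n := L ^ j with hn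
    have hnL : L ^ (j + 1) = n * L := by rw [hn, pow_succ]
    -- rewrite the finer level as `n * L` (definitional up to the instance)
    have eK : @Kunit d (L ^ (j + 1)) ⟨pow_ne_zero (j + 1) (NeZero.ne L)⟩ a m2 x = Kunit (n * L) a m2 x := rfl
    rw [eK, Kunit_mul_eq]
    have eK0 : @Kunit d (L ^ j) ⟨pow_ne_zero j (NeZero.ne L)⟩ a m2 x = Kunit n a m2 x := rfl
    rw [eK0]
    unfold Kunit
    rw [← mul_sub, ← Finset.sum_sub_distrib]
    -- the mean of the sub-averaged differences
    set Kd : (Fin (d + 1) → Fin n) → ℂ := fun τ =>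
      (((L : ℂ) ^ (d + 1)))⁻¹ * ∑ ρ : Fin (d + 1) → Fin L, latticeKernel (G (n * L) a m2 (Tsub n L τ ρ)) x - latticeKernel (G n a m2 τ) x
    have hrms := h2 n a m2 le_rfl le_rfl hm le_rfl x
    have hn0 : (0 : ℝ) < n := by exact_mod_cast Nat.pos_of_ne_zero (NeZero.ne n)
    have hcard : (Fintype.card (Fin (d + 1) → Fin n) : ℝ) = (n : ℝ) ^ (d + 1) := by
      rw [Fintype.card_pi, Finset.prod_const, Fintype.card_fin, Finset.card_univ, Fintype.card_fin]; push_cast; rfl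
    have hmean := norm_mean_le_sqrt Kd
    rw [hcard] at hmean
    rw [norm_mul, norm_inv, norm_pow, Complex.norm_natCast]
    have hnpow : (0 : ℝ) < (n : ℝ) ^ (d + 1) := by positivity
    rw [inv_mul_le_iff₀ hnpow]
    calc ‖∑ τ : Fin (d + 1) → Fin n, Kd τ‖ ≤ Real.sqrt ((n : ℝ) ^ (d + 1)) * Real.sqrt (sqNorm Kd) := hmean
      _ ≤ Real.sqrt ((n : ℝ) ^ (d + 1)) *
            (48 ^ (d + 1) * Real.sqrt ((n : ℝ) ^ (d + 1)) * (Ccol (d + 1) L a m2 c / (n : ℝ) ^ 2) * Real.exp (-(κ₂ * supNorm x))) :=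
          mul_le_mul_of_nonneg_left hrms (Real.sqrt_nonneg _)
      _ = (Real.sqrt ((n : ℝ) ^ (d + 1)) * Real.sqrt ((n : ℝ) ^ (d + 1)))
            * (48 ^ (d + 1) * (Ccol (d + 1) L a m2 c / (n : ℝ) ^ 2) * Real.exp (-(κ₂ * supNorm x))) := by ring
      _ = (n : ℝ) ^ (d + 1) * (C₂ * (((n : ℝ) ^ 2)⁻¹) * Real.exp (-(κ₂ * supNorm x))) := by
          rw [Real.mul_self_sqrt hnpow.le, hC₂]; ring
      _ ≤ (n : ℝ) ^ (d + 1) * (max M C₂ * (((L : ℝ) ^ 2)⁻¹) ^ j * Real.exp (-(min κ₁ κ₂ * supNorm x))) := by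
          have hexp : Real.exp (-(κ₂ * supNorm x)) ≤ Real.exp (-(min κ₁ κ₂ * supNorm x)) :=
            Real.exp_le_exp.mpr (by nlinarith [min_le_right κ₁ κ₂, supNorm_nonneg x])
          have hnn : ((n : ℝ) ^ 2)⁻¹ = (((L : ℝ) ^ 2)⁻¹) ^ j := by
            rw [hn]; push_cast; rw [← pow_mul, inv_pow, ← pow_mul, Nat.mul_comm]
          rw [hnn]
          gcongr
          · exact le_max_right _ _

end Summit.QuantumFields.BalabanUV.Beta.GAN24.SubAveragingUnitTower
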